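import Literature.NumberTheory.Automorphic.TwistedAsaiPole
import Literature.NumberTheory.Automorphic.TunnellOctahedralGlobal
import Literature.NumberTheory.Automorphic.AutomorphicRepsGLSatakeFlathProofs
import HarnessLib

/-!
# The twisted Asai factorisation `L^{S_E}(s, P × P^∨) = L^S(s, P, As⁺ ⊗ χ) · L^S(s, P, As⁻ ⊗ χ)`
# on Satake data of `GL₂` — helper for stub `stub_twistedAsaiPole`, line `Sketch`
(crux `Summit.Langlands.Langlands.Theses.ParityBlindBianchi.QuadraticDescentGL2`, item stmt-Langlands-16811)

Stub worker, 2026-08-17.  Sorry-free glue for the analytic stub of the quadratic-descent skeleton.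

**Setting.** `E/F` quadratic (`finrank F E = 2`) with non-trivial automorphism `c`; `S` a set of
finite places of `F` off which the `c`-fixed places are inert (`f = 2`, as in an Asai datum);
`A : SatakeFamily E` (rank `2`: `card (A w) = 2`); `m : v ↦ m_v ∈ ℂ` a value family on `F` (the values
`χ(ϖ_v)` of a Hecke character `χ` of `F`).  Hypotheses off `S_E = {w : w ∩ 𝓞 F ∈ S}`:
*Galois-stability* `A (c • w) = A w` and the *central-character relation*
`e₂(A w) · m_v^{f(w|v)} = 1` (`ω_P = χ⁻¹ ∘ N_{E/F}` on Satake data).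

**Main statements (all proved).**

* `multiset_map_inv_eq_map_mul_of_card_eq_two`, `satakePairPolynomial_self_dual_of_card_eq_two` — on
  `GL₂` the contragredient is a twist: `{a, b}⁻¹ = (ab)⁻¹ · {a, b}`, hence
  `det(1 - t ⊗ t^∨ X) = det(1 - t ⊗ t X) ∘ (u X)` for `e₂(t) u = 1`.
* `exists_twistScalars` — scalars `t_w` at the places of `E` with `t_w = m_v` at a `c`-fixed `w | v`
  and `t_w t_{c w} = m_v` at a `c`-moved one (the unramified values of a character `χ̃` of `E` with
  `χ̃|_{𝔸_F^×} = χ`, realised combinatorially: `m_v` at the chosen place `placeAbove E v`, `1` at its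
  conjugate).
* `partialPairL_dual_eq_partialAsaiLTwist_mul` — **the factorisation for Satake families**:
  `partialPairL S_E A A^∨ s = partialAsaiLTwist S c A m 1 s · partialAsaiLTwist S c A m (-1) s`
  whenever the three products are multipliable: `A ⊗ A^∨ = A_t ⊗ A_t^c` factor by factor
  (`A_t = t · A`; at `w`: `det(1 - t_w t_{cw} · t ⊗ t X) = det(1 - m_v^{f} t ⊗ t X) = det(1 - t ⊗ t^∨ X)`
  by Galois-stability and the central relation), then the accepted untwisted factorisation
  `partialPairL_smul_eq_partialAsaiL_mul` (Mok §2.5; Getz–Hahn (14.8)) for `A_t` and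
  `partialAsaiL_twist_eq_partialAsaiLTwist` (Flicker 1988, p. 296: "replace `π` by its product with a
  character").
* `isAsaiDatum_partialPairL_dual_eq_partialAsaiLTwist_mul` — the same for an Asai datum `(S, A)` of an
  automorphic `P` on `GL₂(𝔸_E)` whose Satake parameters off `S_E` are `c`-stable and satisfy the
  central relation (uniqueness of Satake parameters, Flath — `hasSatakeParamAt_unique_holds`).
* `exists_finite_isAsaiDatum_factorisation` — from the ALMOST-EVERYWHERE hypotheses of the stub
  (`IsGaloisStableSatakeAE F P`, and `e₂(α) χ(ϖ_v)^{f(w|v)} = 1` for a.e. `w` and every Satake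
  parameter `α` at `w` with `χ_v` unramified): a finite set `S₀` of places of `F` such that the
  factorisation holds for EVERY Asai datum `(S, A)` of `P` with `χ.ramifiedPlaces ∪ S₀ ⊆ S`
  (`m = χ.valueAtUniformizer`), granted the three multipliability side conditions at `s`.

What this does NOT give: any analytic statement (poles, convergence); see the stub report.

## References
* C. P. Mok, Mem. AMS 235 (2015), §2.5 (factorisation before Thm. 2.5.4). [Mok2014]
* Y. Z. Flicker, Bull. SMF 116 (1988), p. 296. [Flicker1988]
* J. R. Getz, H. Hahn, GTM 300 (2024), (14.8). [GetzHahn2024]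
* D. Flath, Corvallis 1979, Thm. 3. [FlathCorvallis1979]
-/

set_option linter.dupNamespace false -- project-wide option (lakefile weak.linter.dupNamespace); `Summit.Langlands.Langlands` is the mandated namespace

noncomputable section

open scoped Classical
open Filter Polynomial NumberField IsDedekindDomain
open Literature.NumberTheory.Automorphic Literature.NumberTheory.GaloisRepresentations

namespace Summit.Langlands.Langlands.Theorems.QuadraticDescentGL2.Sketch

/-! ### `GL₂`: the contragredient is a twist by the inverse central value -/

/-- For a two-element multiset `α = {a, b}` and `u` with `(ab) u = 1`: `{a⁻¹, b⁻¹} = {u a, u b}` — on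
`GL₂`, `t^∨ = det(t)⁻¹ · t` on Satake parameters. [folklore] -/
theorem multiset_map_inv_eq_map_mul_of_card_eq_two {α : Multiset ℂ} (hα : Multiset.card α = 2)
    {u : ℂ} (hu : α.prod * u = 1) : α.map (·⁻¹) = α.map (u * ·) := by
  obtain ⟨a, b, rfl⟩ := Multiset.card_eq_two.mp hα
  have hprod : (({a, b} : Multiset ℂ)).prod = a * b := by simp
  rw [hprod] at hu
  have ha : a ≠ 0 := by
    rintro rfl
    simp at hu
  have hb : b ≠ 0 := by
    rintro rfl
    simp at hu
  have hu' : u = (a * b)⁻¹ := eq_inv_of_mul_eq_one_right hu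
  have h1 : u * a = b⁻¹ := by
    rw [hu']
    field_simp
  have h2 : u * b = a⁻¹ := by
    rw [hu']
    field_simp
  simp only [Multiset.insert_eq_cons, Multiset.map_cons, Multiset.map_singleton, h1, h2]
  exact Multiset.cons_swap a⁻¹ b⁻¹ 0

/-- **Anchor of this helper file** (registered sub-goal `twistedAsaiFactorisation_anchor` of the
crux item, so that the file lands with `--supports`): the `GL₂` identity `t^∨ = det(t)⁻¹ · t` on
Satake parameters, `multiset_map_inv_eq_map_mul_of_card_eq_two`. [folklore] -/
theorem twistedAsaiFactorisation_anchor : ∀ (α : Multiset ℂ), Multiset.card α = 2 → ∀ (u : ℂ), α.prod * u = 1 → α.map (·⁻¹) = α.map (u * ·) :=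
  fun _ hα _ hu => multiset_map_inv_eq_map_mul_of_card_eq_two hα hu

/-- **`det(1 - t ⊗ t^∨ X) = det(1 - t ⊗ t X) ∘ (u X)` on `GL₂` when `det(t) u = 1`**: the
Rankin–Selberg polynomial of a rank-two Satake parameter against its dual is the one against itself,
twisted by the inverse central value (`satakePairPolynomial_map_mul_map_mul_eq_comp`). [folklore] -/
theorem satakePairPolynomial_self_dual_of_card_eq_two {α : Multiset ℂ} (hα : Multiset.card α = 2)
    {u : ℂ} (hu : α.prod * u = 1) :
    satakePairPolynomial α (α.map (·⁻¹)) = (satakePairPolynomial α α).comp (C u * X) := by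
  rw [multiset_map_inv_eq_map_mul_of_card_eq_two hα hu]
  have h := satakePairPolynomial_map_mul_map_mul_eq_comp 1 u α α
  simp only [one_mul, Multiset.map_id'] at h
  exact h

/-! ### Twisting scalars above a value family of the base -/

section Places

variable {F E : Type} [Field F] [NumberField F] [Field E] [NumberField E] [Algebra F E]

/-- **Twisting scalars.** For `[E : F] = 2`, `c ≠ 1` and a value family `m` on the finite places of
`F` there are scalars `t_w` at the finite places of `E` with `t_w = m_v` when `w | v` is `c`-fixed and
`t_w · t_{c • w} = m_v` when it is `c`-moved — the unramified values of any character `χ̃` of `E`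
restricting to `χ` on `𝔸_F^×` behave this way (`ϖ_v` stays a uniformizer at an inert `w`, and
`F_v^× ↪ E_w^× × E_{w̄}^×` diagonally at a split `v`); here simply `t = m_v` at the chosen place
`placeAbove E v` and `t = 1` at the other place above a split `v`. [folklore] -/
theorem exists_twistScalars (h2 : Module.finrank F E = 2) {c : E ≃ₐ[F] E} (hc : c ≠ 1)
    (m : HeightOneSpectrum (𝓞 F) → ℂ) :
    ∃ t : HeightOneSpectrum (𝓞 E) → ℂ,
      (∀ w : HeightOneSpectrum (𝓞 E), c • w = w → t w = m (w.under (𝓞 F))) ∧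
      (∀ w : HeightOneSpectrum (𝓞 E), c • w ≠ w → t w * t (c • w) = m (w.under (𝓞 F))) := by
  classical
  refine ⟨fun w => if placeAbove E (w.under (𝓞 F)) = w then m (w.under (𝓞 F)) else 1, ?_, ?_⟩
  · intro w hw
    have hpa : placeAbove E (w.under (𝓞 F)) = w := by
      rcases HeightOneSpectrum.eq_or_eq_smul_of_under_eq h2 hc
        (placeAbove_under (E := E) (w.under (𝓞 F))) with h | h
      · exact h
      · rw [h, hw]
    simp only [hpa, if_true]
  · intro w hw
    have hcu : (c • w).under (𝓞 F) = w.under (𝓞 F) := HeightOneSpectrum.under_algEquiv_smul F E c w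
    simp only [hcu]
    rcases HeightOneSpectrum.eq_or_eq_smul_of_under_eq h2 hc
      (placeAbove_under (E := E) (w.under (𝓞 F))) with h | h
    · have h' : placeAbove E (w.under (𝓞 F)) ≠ c • w := by
        rw [h]
        exact fun e => hw e.symm
      rw [if_pos h, if_neg h', mul_one]
    · have h' : placeAbove E (w.under (𝓞 F)) ≠ w := by
        rw [h]
        exact hw
      rw [if_neg h', if_pos h, one_mul]

omit [NumberField E] in
/-- **The local Asai polynomial of the twisted family, evaluated**: with scalars `t` inducing the
value family `m` off `S` (as in `partialAsaiL_twist_eq_partialAsaiLTwist`), for `v ∉ S`,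
`P^{η}_{A ⊗ t}(w_v)(x) = P^{η}_{A}(w_v)(m_v x)` — the pointwise content of Flicker's reduction
"replace `π` by its product with a character" (1988, p. 296). [cite: Flicker1988, p. 296] -/
theorem eval_asaiLocalPolynomial_twist (c : E ≃ₐ[F] E) (A : SatakeFamily E)
    (t : HeightOneSpectrum (𝓞 E) → ℂ) {m : HeightOneSpectrum (𝓞 F) → ℂ}
    {S : Set (HeightOneSpectrum (𝓞 F))}
    (hinert : ∀ w : HeightOneSpectrum (𝓞 E), w.under (𝓞 F) ∉ S → c • w = w →
      m (w.under (𝓞 F)) = t w)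
    (hsplit : ∀ w : HeightOneSpectrum (𝓞 E), w.under (𝓞 F) ∉ S → c • w ≠ w →
      m (w.under (𝓞 F)) = t w * t (c • w))
    (η : ℤˣ) (x : ℂ) {v : HeightOneSpectrum (𝓞 F)} (hv : v ∉ S) :
    (asaiLocalPolynomial c (fun w => (A w).map (t w * ·)) η (placeAbove E v)).eval x =
      (asaiLocalPolynomial c A η (placeAbove E v)).eval (m v * x) := by
  have hv' : (placeAbove E v).under (𝓞 F) ∉ S := by rw [placeAbove_under]; exact hv
  by_cases hw : c • placeAbove E v = placeAbove E v
  · rw [asaiLocalPolynomial_twist_of_smul_eq A t η hw, eval_comp, eval_mul, eval_C, eval_X,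
      ← hinert _ hv' hw, placeAbove_under]
  · rw [asaiLocalPolynomial_twist_of_smul_ne A t η hw, eval_comp, eval_mul, eval_C, eval_X,
      ← hsplit _ hv' hw, placeAbove_under]

/-! ### The factorisation for Satake families -/

/-- **`L^{S_E}(s, A × A^∨) = L^S(s, A, As⁺ ⊗ m) · L^S(s, A, As⁻ ⊗ m)` for a rank-two Satake family.**
For `[E : F] = 2`, `c ≠ 1`, a set `S` of finite places of `F` off which the `c`-fixed places are inert
(`f = 2`), a Satake family `A` over `E` of rank `2` off `S_E`, `c`-stable off `S_E`
(`A (c • w) = A w`: the Satake data of `P` and `P^c = P ∘ c` agree), and a value family `m` on `F` with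
`e₂(A w) · m_v^{f(w|v)} = 1` off `S_E` (`ω_P = χ⁻¹ ∘ N_{E/F}` on Satake data, `m_v = χ(ϖ_v)`): the
partial Rankin–Selberg product of `A` against its dual family `A^∨ = A⁻¹` over the places of `E` off
`S_E` equals the product of the two `m`-twisted partial Asai `L`-functions, whenever the three
products are multipliable.  Proof: with twisting scalars `t` above `m` (`exists_twistScalars`) and
`A_t = t · A`, factor by factor `det(1 - A_t(w) ⊗ A_t(cw) X) = det(1 - A(w) ⊗ A(w) X) ∘ (t_w t_{cw} X)`
with `t_w t_{cw} = m_v^{f(w|v)} = e₂(A w)⁻¹`, which is `det(1 - A(w) ⊗ A(w)^∨ X)` on `GL₂`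
(`satakePairPolynomial_self_dual_of_card_eq_two`); then Mok's factorisation for `A_t`
(`partialPairL_smul_eq_partialAsaiL_mul`) and `L^S(s, A_t, As^η) = L^S(s, A, As^η ⊗ m)`
(`partialAsaiL_twist_eq_partialAsaiLTwist`).
[cite: Mok2014, §2.5, factorisation before Thm. 2.5.4] [cite: Flicker1988, p. 296] -/
theorem partialPairL_dual_eq_partialAsaiLTwist_mul (h2 : Module.finrank F E = 2) {c : E ≃ₐ[F] E}
    (hc : c ≠ 1) (S : Set (HeightOneSpectrum (𝓞 F))) (A : SatakeFamily E)
    (m : HeightOneSpectrum (𝓞 F) → ℂ)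
    (hstab : ∀ w : HeightOneSpectrum (𝓞 E), w.under (𝓞 F) ∉ S → A (c • w) = A w)
    (hcard : ∀ w : HeightOneSpectrum (𝓞 E), w.under (𝓞 F) ∉ S → Multiset.card (A w) = 2)
    (hcent : ∀ w : HeightOneSpectrum (𝓞 E), w.under (𝓞 F) ∉ S →
      (A w).prod * m (w.under (𝓞 F)) ^ w.asIdeal.inertiaDeg (𝓞 F) = 1)
    (hinert : ∀ w : HeightOneSpectrum (𝓞 E), w.under (𝓞 F) ∉ S → c • w = w →
      w.asIdeal.inertiaDeg (𝓞 F) = 2)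
    {s : ℂ}
    (hE : Multipliable fun w : {w : HeightOneSpectrum (𝓞 E) // w.under (𝓞 F) ∉ S} =>
      ((satakePairPolynomial (A w.1) ((A w.1).map (·⁻¹))).eval ((w.1.residueCard : ℂ) ^ (-s)))⁻¹)
    (hplus : Multipliable fun v : {v : HeightOneSpectrum (𝓞 F) // v ∉ S} =>
      ((asaiLocalPolynomial c A 1 (placeAbove E v.1)).eval
        (m v.1 * (v.1.residueCard : ℂ) ^ (-s)))⁻¹)
    (hminus : Multipliable fun v : {v : HeightOneSpectrum (𝓞 F) // v ∉ S} =>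
      ((asaiLocalPolynomial c A (-1) (placeAbove E v.1)).eval
        (m v.1 * (v.1.residueCard : ℂ) ^ (-s)))⁻¹) :
    partialPairL {w : HeightOneSpectrum (𝓞 E) | w.under (𝓞 F) ∈ S} A (fun w => (A w).map (·⁻¹)) s =
      partialAsaiLTwist S c A m 1 s * partialAsaiLTwist S c A m (-1) s := by
  classical
  obtain ⟨t, ht₁, ht₂⟩ := exists_twistScalars h2 hc m
  have hmS : ∀ w : HeightOneSpectrum (𝓞 E), w.under (𝓞 F) ∉ S → c • w = w →
      m (w.under (𝓞 F)) = t w := fun w _ hcw => (ht₁ w hcw).symm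
  have hmS' : ∀ w : HeightOneSpectrum (𝓞 E), w.under (𝓞 F) ∉ S → c • w ≠ w →
      m (w.under (𝓞 F)) = t w * t (c • w) := fun w _ hcw => (ht₂ w hcw).symm
  -- the local identity over `E`: `A_t(w) ⊗ A_t(cw) ≡ A(w) ⊗ A(w)^∨`
  have hloc : ∀ w : HeightOneSpectrum (𝓞 E), w.under (𝓞 F) ∉ S →
      satakePairPolynomial ((A w).map (t w * ·)) ((A (c • w)).map (t (c • w) * ·)) =
        satakePairPolynomial (A w) ((A w).map (·⁻¹)) := by
    intro w hw
    have hu : (A w).prod * (t w * t (c • w)) = 1 := by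
      by_cases hcw : c • w = w
      · rw [hcw, ht₁ w hcw, ← hcent w hw, hinert w hw hcw, pow_two]
      · rw [ht₂ w hcw, ← hcent w hw, HeightOneSpectrum.inertiaDeg_eq_one_of_smul_ne h2 hcw, pow_one]
    rw [hstab w hw, satakePairPolynomial_map_mul_map_mul_eq_comp,
      satakePairPolynomial_self_dual_of_card_eq_two (hcard w hw) hu]
  -- Step 1: the two partial Rankin–Selberg products over `E` agree, factor by factor
  have hpair : partialPairL {w : HeightOneSpectrum (𝓞 E) | w.under (𝓞 F) ∈ S} A
      (fun w => (A w).map (·⁻¹)) s =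
      partialPairL {w : HeightOneSpectrum (𝓞 E) | w.under (𝓞 F) ∈ S} (fun w => (A w).map (t w * ·))
        (fun w => (A (c • w)).map (t (c • w) * ·)) s := by
    unfold partialPairL
    exact tprod_congr fun w => by rw [hloc w.1 w.2]
  -- Step 2: multipliability transfers along the local identities
  have hE' : Multipliable fun w : {w : HeightOneSpectrum (𝓞 E) // w.under (𝓞 F) ∉ S} =>
      ((satakePairPolynomial ((A w.1).map (t w.1 * ·)) ((A (c • w.1)).map (t (c • w.1) * ·))).eval
        ((w.1.residueCard : ℂ) ^ (-s)))⁻¹ :=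
    hE.congr fun w => by rw [hloc w.1 w.2]
  have hplus' : Multipliable fun v : {v : HeightOneSpectrum (𝓞 F) // v ∉ S} =>
      ((asaiLocalPolynomial c (fun w => (A w).map (t w * ·)) 1 (placeAbove E v.1)).eval
        ((v.1.residueCard : ℂ) ^ (-s)))⁻¹ :=
    hplus.congr fun v => by rw [eval_asaiLocalPolynomial_twist c A t hmS hmS' 1 _ v.2]
  have hminus' : Multipliable fun v : {v : HeightOneSpectrum (𝓞 F) // v ∉ S} =>
      ((asaiLocalPolynomial c (fun w => (A w).map (t w * ·)) (-1) (placeAbove E v.1)).eval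
        ((v.1.residueCard : ℂ) ^ (-s)))⁻¹ :=
    hminus.congr fun v => by rw [eval_asaiLocalPolynomial_twist c A t hmS hmS' (-1) _ v.2]
  -- Step 3: Mok's factorisation for `A_t`, and `L^S(A_t, As^η) = L^S(A, As^η ⊗ m)`
  have hfac := partialPairL_smul_eq_partialAsaiL_mul h2 hc S (fun w => (A w).map (t w * ·)) hinert
    hE' hplus' hminus'
  rw [hpair, hfac, partialAsaiL_twist_eq_partialAsaiLTwist S c A t hmS hmS' 1 s,
    partialAsaiL_twist_eq_partialAsaiLTwist S c A t hmS hmS' (-1) s]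

/-! ### The factorisation for Asai data of an automorphic representation of `GL₂(𝔸_E)` -/

/-- **The factorisation for an Asai datum of `P` on `GL₂(𝔸_E)` with `c`-stable Satake data and
`ω_P = χ⁻¹ ∘ N` off `S`.**  If `(S, A)` is an Asai datum of `P` (`IsAsaiDatum`), the Satake
parameters of `P` off `S_E` are `c`-stable (`P.HasSatakeParamAt w α → P.HasSatakeParamAt (c • w) α`)
and satisfy `e₂(α) m_v^{f(w|v)} = 1`, then
`L^{S_E}(s, A × A^∨) = L^S(s, A, As⁺ ⊗ m) L^S(s, A, As⁻ ⊗ m)` granted the three multipliability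
conditions (`A (c • w) = A w` by the uniqueness of Satake parameters, Flath 1979 Thm. 3 —
`hasSatakeParamAt_unique_holds`; `card (A w) = 2` by `HasSatakeParamAt.card_eq`).
[cite: Mok2014, §2.5, factorisation before Thm. 2.5.4] [cite: FlathCorvallis1979, Thm. 3] -/
theorem isAsaiDatum_partialPairL_dual_eq_partialAsaiLTwist_mul (h2 : Module.finrank F E = 2)
    {c : E ≃ₐ[F] E} (hc : c ≠ 1) {hE : isCompact_glFiniteIntegralLevel 2 E}
    {P : AutomorphicRepData (AutomorphyDatum.gl 2 E hE)} {S : Set (HeightOneSpectrum (𝓞 F))}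
    {A : SatakeFamily E} (hSA : P.IsAsaiDatum c S A) (m : HeightOneSpectrum (𝓞 F) → ℂ)
    (hstab : ∀ w : HeightOneSpectrum (𝓞 E), w.under (𝓞 F) ∉ S → ∀ α : Multiset ℂ,
      P.HasSatakeParamAt w α → P.HasSatakeParamAt (c • w) α)
    (hcent : ∀ w : HeightOneSpectrum (𝓞 E), w.under (𝓞 F) ∉ S → ∀ α : Multiset ℂ,
      P.HasSatakeParamAt w α → α.prod * m (w.under (𝓞 F)) ^ w.asIdeal.inertiaDeg (𝓞 F) = 1)
    {s : ℂ}
    (hEm : Multipliable fun w : {w : HeightOneSpectrum (𝓞 E) // w.under (𝓞 F) ∉ S} =>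
      ((satakePairPolynomial (A w.1) ((A w.1).map (·⁻¹))).eval ((w.1.residueCard : ℂ) ^ (-s)))⁻¹)
    (hplus : Multipliable fun v : {v : HeightOneSpectrum (𝓞 F) // v ∉ S} =>
      ((asaiLocalPolynomial c A 1 (placeAbove E v.1)).eval
        (m v.1 * (v.1.residueCard : ℂ) ^ (-s)))⁻¹)
    (hminus : Multipliable fun v : {v : HeightOneSpectrum (𝓞 F) // v ∉ S} =>
      ((asaiLocalPolynomial c A (-1) (placeAbove E v.1)).eval
        (m v.1 * (v.1.residueCard : ℂ) ^ (-s)))⁻¹) :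
    partialPairL {w : HeightOneSpectrum (𝓞 E) | w.under (𝓞 F) ∈ S} A (fun w => (A w).map (·⁻¹)) s =
      partialAsaiLTwist S c A m 1 s * partialAsaiLTwist S c A m (-1) s := by
  refine partialPairL_dual_eq_partialAsaiLTwist_mul h2 hc S A m (fun w hw => ?_)
    (fun w hw => (hSA.hasSatakeParamAt hw).card_eq) (fun w hw => hcent w hw _ (hSA.hasSatakeParamAt hw))
    hSA.2.2 hEm hplus hminus
  have hcw : (c • w).under (𝓞 F) ∉ S := by
    rw [HeightOneSpectrum.under_algEquiv_smul F E c w]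
    exact hw
  exact P.hasSatakeParamAt_unique_holds (hSA.hasSatakeParamAt hcw)
    (hstab w hw _ (hSA.hasSatakeParamAt hw))

/-- **From the almost-everywhere hypotheses of the stub to every large Asai datum.**  For `P`
automorphic on `GL₂(𝔸_E)` with `Gal(E/F)`-stable Satake data a.e. (`IsGaloisStableSatakeAE`) and a
Hecke character `χ` of `F` with `e₂(α) χ(ϖ_v)^{f(w|v)} = 1` for a.e. `w` and every Satake parameter `α`
of `P` at `w` with `χ_v` unramified (`ω_P = χ⁻¹ ∘ N_{E/F}`), there is a finite set `S₀` of places of `F`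
(those below the finitely many exceptional `w`) such that for every Asai datum `(S, A)` of `P` with
`χ.ramifiedPlaces ⊆ S` and `S₀ ⊆ S`, and every `s` at which the three products are multipliable,
`L^{S_E}(s, A × A^∨) = L^S(s, P, As⁺ ⊗ χ) · L^S(s, P, As⁻ ⊗ χ)` with
`L^S(s, P, As^η ⊗ χ) = partialAsaiLTwist S c A χ.valueAtUniformizer η s`.  This is the
factorisation `L^{S_E}(s, P × P^∨) = L^S(s, P, As⁺ ⊗ χ) L^S(s, P, As⁻ ⊗ χ)` of the printed route
(`P^∨ ≅ P ⊗ (χ ∘ N) ≅ P^c ⊗ (χ ∘ N)`; Mok §2.5, Flicker 1988 p. 296) on Satake data.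
[cite: Mok2014, §2.5, factorisation before Thm. 2.5.4] [cite: Flicker1988, p. 296] -/
theorem exists_finite_isAsaiDatum_factorisation (h2 : Module.finrank F E = 2) {c : E ≃ₐ[F] E}
    (hc : c ≠ 1) {hE : isCompact_glFiniteIntegralLevel 2 E}
    (P : AutomorphicRepData (AutomorphyDatum.gl 2 E hE)) (χ : HeckeCharacter F)
    (hst : IsGaloisStableSatakeAE F P)
    (hχ : ∀ᶠ w : HeightOneSpectrum (𝓞 E) in cofinite, ∀ α : Multiset ℂ,
      P.HasSatakeParamAt w α → χ.IsUnramifiedAt (w.under (𝓞 F)) →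
        α.prod * χ.valueAtUniformizer (w.under (𝓞 F)) ^ w.asIdeal.inertiaDeg (𝓞 F) = 1) :
    ∃ S₀ : Set (HeightOneSpectrum (𝓞 F)), S₀.Finite ∧
      ∀ ⦃S : Set (HeightOneSpectrum (𝓞 F))⦄ ⦃A : SatakeFamily E⦄, P.IsAsaiDatum c S A →
        χ.ramifiedPlaces ⊆ S → S₀ ⊆ S → ∀ ⦃s : ℂ⦄,
        (Multipliable fun w : {w : HeightOneSpectrum (𝓞 E) // w.under (𝓞 F) ∉ S} =>
          ((satakePairPolynomial (A w.1) ((A w.1).map (·⁻¹))).eval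
            ((w.1.residueCard : ℂ) ^ (-s)))⁻¹) →
        (Multipliable fun v : {v : HeightOneSpectrum (𝓞 F) // v ∉ S} =>
          ((asaiLocalPolynomial c A 1 (placeAbove E v.1)).eval
            (χ.valueAtUniformizer v.1 * (v.1.residueCard : ℂ) ^ (-s)))⁻¹) →
        (Multipliable fun v : {v : HeightOneSpectrum (𝓞 F) // v ∉ S} =>
          ((asaiLocalPolynomial c A (-1) (placeAbove E v.1)).eval
            (χ.valueAtUniformizer v.1 * (v.1.residueCard : ℂ) ^ (-s)))⁻¹) →
        partialPairL {w : HeightOneSpectrum (𝓞 E) | w.under (𝓞 F) ∈ S} A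
            (fun w => (A w).map (·⁻¹)) s =
          partialAsaiLTwist S c A (fun v => χ.valueAtUniformizer v) 1 s *
            partialAsaiLTwist S c A (fun v => χ.valueAtUniformizer v) (-1) s := by
  -- the finitely many exceptional places of `E`, and the places of `F` below them
  set B : Set (HeightOneSpectrum (𝓞 E)) := {w | ¬ ((∀ w' : HeightOneSpectrum (𝓞 E),
      w'.asIdeal.under (𝓞 F) = w.asIdeal.under (𝓞 F) →
        ∀ α : Multiset ℂ, P.HasSatakeParamAt w α → P.HasSatakeParamAt w' α) ∧
      (∀ α : Multiset ℂ, P.HasSatakeParamAt w α → χ.IsUnramifiedAt (w.under (𝓞 F)) →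
        α.prod * χ.valueAtUniformizer (w.under (𝓞 F)) ^ w.asIdeal.inertiaDeg (𝓞 F) = 1))} with hB
  have hBfin : B.Finite := by
    have h := hst.and hχ
    rw [Filter.eventually_cofinite] at h
    exact h
  refine ⟨(fun w : HeightOneSpectrum (𝓞 E) => w.under (𝓞 F)) '' B, hBfin.image _, ?_⟩
  intro S A hSA hχS hS₀ s hEm hplus hminus
  -- off `S_E` nothing is exceptional
  have hgood : ∀ w : HeightOneSpectrum (𝓞 E), w.under (𝓞 F) ∉ S → w ∉ B := fun w hw hwB =>
    hw (hS₀ ⟨w, hwB, rfl⟩)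
  refine isAsaiDatum_partialPairL_dual_eq_partialAsaiLTwist_mul h2 hc hSA
    (fun v => χ.valueAtUniformizer v) (fun w hw α hα => ?_) (fun w hw α hα => ?_) hEm hplus hminus
  · have hw' := hgood w hw
    simp only [hB, Set.mem_setOf_eq, not_not] at hw'
    refine hw'.1 (c • w) ?_ α hα
    exact congrArg HeightOneSpectrum.asIdeal (HeightOneSpectrum.under_algEquiv_smul F E c w)
  · have hw' := hgood w hw
    simp only [hB, Set.mem_setOf_eq, not_not] at hw'
    have hun : χ.IsUnramifiedAt (w.under (𝓞 F)) := by
      by_contra h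
      exact hw (hχS h)
    exact hw'.2 α hα hun

end Places

end Summit.Langlands.Langlands.Theorems.QuadraticDescentGL2.Sketch

end
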